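import Summits.CriticalPhenomena.PercolationContinuityZ3.Theorems.PercNearOneGluingNoHeavyLowerTailSunflowerC1FastCensus
import HarnessLib

/-!
# `NoHeavyLowerTail` (crux stmt-CriticalPhenomena-4575), abstract sunflower cubic at LAW level: the census machine, II —
# reordering the petals, the order-free chunk soundness, and the four-coin assembly lemma

Support file (seat `prim-ineq-gen-2` gen 33; `--supports stmt-CriticalPhenomena-4575`).  No `sorry`, no computation.
* `swapPetals F i j` (petals `i`, `j` exchanged; `swapPetals_A/V/core`), `lab_swap01/12/02`, `cellMass_swap01/12/02`, and the
  transfer lemmas `c1_of_swap01/12/02` ((C1) is symmetric in `c₁, c₂, c₃`);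
* **`c1_of_allSunTestCard`**: a passing chunk `[lo, hi)` + completeness ⟹ (C1) at every bias for EVERY sunflower whose core has
  between `lo` and `hi − 1` points (sort the petals by key with at most two exchanges);
* **`c1_fourCoins_of_chunks`**: the six chunks `[0,4) [4,5) [5,6) [6,7) [7,8) [8,17)` + completeness of `upFams 4` ⟹ (C1) for every
  `F : Sunflower (Fin 4)` at every bias.
-/

namespace Summit.CriticalPhenomena.PercolationContinuityZ3.Theorems.SunflowerPartition

namespace SafeCalc

namespace C1Cert

open Finset Bern

variable {n : ℕ}

/-! ### Reordering the petals (the census lists each sunflower once, petals in key order) -/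

/-- The same sunflower with petals `i` and `j` exchanged. [this work] -/
def swapPetals (F : Sunflower (Fin n)) (i j : Fin 3) : Sunflower (Fin n) where
  V := fun k => F.V (Equiv.swap i j k)
  upper := fun k => F.upper _
  inter_eq := by
    intro k l hkl
    rw [F.inter_eq _ _ ((Equiv.injective _).ne hkl), F.inter_eq _ _ ((Equiv.injective (Equiv.swap i j)).ne (by decide : (0 : Fin 3) ≠ 1))]

/-- The up-sets after exchanging petals. [this work] -/
theorem swapPetals_V (F : Sunflower (Fin n)) (i j k : Fin 3) : (swapPetals F i j).V k = F.V (Equiv.swap i j k) := rfl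

/-- The kernel is unchanged by exchanging petals. [this work] -/
theorem swapPetals_A (F : Sunflower (Fin n)) (i j : Fin 3) : (swapPetals F i j).A = F.A :=
  F.inter_eq _ _ ((Equiv.injective (Equiv.swap i j)).ne (by decide : (0 : Fin 3) ≠ 1))

/-- The core (as an intersection) is unchanged by exchanging petals. [this work] -/
theorem swapPetals_core (F : Sunflower (Fin n)) (i j : Fin 3) :
    (swapPetals F i j).V 0 ∩ (swapPetals F i j).V 1 = F.V 0 ∩ F.V 1 := swapPetals_A F i j

/-- Labels after exchanging petals `0` and `1`. [this work] -/
theorem lab_swap01 (F : Sunflower (Fin n)) (S : Finset (Fin n)) :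
    (swapPetals F 0 1).lab S = (if F.lab S = 1 then (2 : Fin 5) else if F.lab S = 2 then (1 : Fin 5) else if F.lab S = 3 then (3 : Fin 5) else F.lab S) := by
  have e0 : Equiv.swap (0 : Fin 3) 1 0 = 1 := by decide
  have e1 : Equiv.swap (0 : Fin 3) 1 1 = 0 := by decide
  have e2 : Equiv.swap (0 : Fin 3) 1 2 = 2 := by decide
  have hx : ∀ {a b : Fin 3}, a ≠ b → S ∈ F.V a → S ∈ F.V b → S ∈ F.A := fun hab ha hb => F.mem_A_of_mem_mem hab ha hb
  simp only [Sunflower.lab, swapPetals_A]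
  simp only [swapPetals_V, e0, e1, e2]
  by_cases hA : S ∈ F.A
  · simp [hA]
  by_cases h0 : S ∈ F.V 0
  · have h1 : S ∉ F.V 1 := fun h => hA (hx (by decide) h0 h)
    have h2 : S ∉ F.V 2 := fun h => hA (hx (by decide) h0 h)
    simp_all
  by_cases h1 : S ∈ F.V 1
  · have h2 : S ∉ F.V 2 := fun h => hA (hx (by decide) h1 h)
    simp_all
  by_cases h2 : S ∈ F.V 2
  · simp [hA, h0, h1, h2]
  · simp [hA, h0, h1, h2]

/-- Cell masses after exchanging petals `0` and `1`. [this work] -/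
theorem cellMass_swap01 (F : Sunflower (Fin n)) (x : Fin n → ℝ) :
    cellMass (swapPetals F 0 1) 0 x = cellMass F 0 x ∧ cellMass (swapPetals F 0 1) 4 x = cellMass F 4 x ∧
    cellMass (swapPetals F 0 1) 1 x = cellMass F 2 x ∧ cellMass (swapPetals F 0 1) 2 x = cellMass F 1 x ∧
    cellMass (swapPetals F 0 1) 3 x = cellMass F 3 x := by
  refine ⟨?_, ?_, ?_, ?_, ?_⟩
  all_goals
    unfold cellMass
    refine sum_congr rfl fun S _ => ?_
    rw [lab_swap01]
    generalize F.lab S = v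
    fin_cases v <;> simp

/-- (C1) transfers from `swapPetals F 0 1` to `F`. [this work] -/
theorem c1_of_swap01 (F : Sunflower (Fin n)) (x : Fin n → ℝ)
    (h : cellMass (swapPetals F 0 1) 1 x * cellMass (swapPetals F 0 1) 2 x * cellMass (swapPetals F 0 1) 3 x ≤
      max (cellMass (swapPetals F 0 1) 4 x) (cellMass (swapPetals F 0 1) 0 x) *
        (cellMass (swapPetals F 0 1) 4 x * cellMass (swapPetals F 0 1) 0 x
          - (cellMass (swapPetals F 0 1) 1 x * cellMass (swapPetals F 0 1) 2 x
            + cellMass (swapPetals F 0 1) 1 x * cellMass (swapPetals F 0 1) 3 x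
            + cellMass (swapPetals F 0 1) 2 x * cellMass (swapPetals F 0 1) 3 x))) :
    cellMass F 1 x * cellMass F 2 x * cellMass F 3 x ≤
      max (cellMass F 4 x) (cellMass F 0 x) *
        (cellMass F 4 x * cellMass F 0 x
          - (cellMass F 1 x * cellMass F 2 x + cellMass F 1 x * cellMass F 3 x + cellMass F 2 x * cellMass F 3 x)) := by
  obtain ⟨hb, ha, e1, e2, e3⟩ := cellMass_swap01 F x
  rw [hb, ha, e1, e2, e3] at h
  have hp : cellMass F 2 x * cellMass F 1 x * cellMass F 3 x = cellMass F 1 x * cellMass F 2 x * cellMass F 3 x := by ring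
  have hq : cellMass F 2 x * cellMass F 1 x + cellMass F 2 x * cellMass F 3 x
      + cellMass F 1 x * cellMass F 3 x =
      cellMass F 1 x * cellMass F 2 x + cellMass F 1 x * cellMass F 3 x + cellMass F 2 x * cellMass F 3 x := by ring
  rw [hp, hq] at h
  exact h

/-- Labels after exchanging petals `1` and `2`. [this work] -/
theorem lab_swap12 (F : Sunflower (Fin n)) (S : Finset (Fin n)) :
    (swapPetals F 1 2).lab S = (if F.lab S = 1 then (1 : Fin 5) else if F.lab S = 2 then (3 : Fin 5) else if F.lab S = 3 then (2 : Fin 5) else F.lab S) := by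
  have e0 : Equiv.swap (1 : Fin 3) 2 0 = 0 := by decide
  have e1 : Equiv.swap (1 : Fin 3) 2 1 = 2 := by decide
  have e2 : Equiv.swap (1 : Fin 3) 2 2 = 1 := by decide
  have hx : ∀ {a b : Fin 3}, a ≠ b → S ∈ F.V a → S ∈ F.V b → S ∈ F.A := fun hab ha hb => F.mem_A_of_mem_mem hab ha hb
  simp only [Sunflower.lab, swapPetals_A]
  simp only [swapPetals_V, e0, e1, e2]
  by_cases hA : S ∈ F.A
  · simp [hA]
  by_cases h0 : S ∈ F.V 0
  · have h1 : S ∉ F.V 1 := fun h => hA (hx (by decide) h0 h)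
    have h2 : S ∉ F.V 2 := fun h => hA (hx (by decide) h0 h)
    simp_all
  by_cases h1 : S ∈ F.V 1
  · have h2 : S ∉ F.V 2 := fun h => hA (hx (by decide) h1 h)
    simp_all
  by_cases h2 : S ∈ F.V 2
  · simp [hA, h0, h1, h2]
  · simp [hA, h0, h1, h2]

/-- Cell masses after exchanging petals `1` and `2`. [this work] -/
theorem cellMass_swap12 (F : Sunflower (Fin n)) (x : Fin n → ℝ) :
    cellMass (swapPetals F 1 2) 0 x = cellMass F 0 x ∧ cellMass (swapPetals F 1 2) 4 x = cellMass F 4 x ∧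
    cellMass (swapPetals F 1 2) 1 x = cellMass F 1 x ∧ cellMass (swapPetals F 1 2) 2 x = cellMass F 3 x ∧
    cellMass (swapPetals F 1 2) 3 x = cellMass F 2 x := by
  refine ⟨?_, ?_, ?_, ?_, ?_⟩
  all_goals
    unfold cellMass
    refine sum_congr rfl fun S _ => ?_
    rw [lab_swap12]
    generalize F.lab S = v
    fin_cases v <;> simp

/-- (C1) transfers from `swapPetals F 1 2` to `F`. [this work] -/
theorem c1_of_swap12 (F : Sunflower (Fin n)) (x : Fin n → ℝ)
    (h : cellMass (swapPetals F 1 2) 1 x * cellMass (swapPetals F 1 2) 2 x * cellMass (swapPetals F 1 2) 3 x ≤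
      max (cellMass (swapPetals F 1 2) 4 x) (cellMass (swapPetals F 1 2) 0 x) *
        (cellMass (swapPetals F 1 2) 4 x * cellMass (swapPetals F 1 2) 0 x
          - (cellMass (swapPetals F 1 2) 1 x * cellMass (swapPetals F 1 2) 2 x
            + cellMass (swapPetals F 1 2) 1 x * cellMass (swapPetals F 1 2) 3 x
            + cellMass (swapPetals F 1 2) 2 x * cellMass (swapPetals F 1 2) 3 x))) :
    cellMass F 1 x * cellMass F 2 x * cellMass F 3 x ≤
      max (cellMass F 4 x) (cellMass F 0 x) *
        (cellMass F 4 x * cellMass F 0 x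
          - (cellMass F 1 x * cellMass F 2 x + cellMass F 1 x * cellMass F 3 x + cellMass F 2 x * cellMass F 3 x)) := by
  obtain ⟨hb, ha, e1, e2, e3⟩ := cellMass_swap12 F x
  rw [hb, ha, e1, e2, e3] at h
  have hp : cellMass F 1 x * cellMass F 3 x * cellMass F 2 x = cellMass F 1 x * cellMass F 2 x * cellMass F 3 x := by ring
  have hq : cellMass F 1 x * cellMass F 3 x + cellMass F 1 x * cellMass F 2 x
      + cellMass F 3 x * cellMass F 2 x =
      cellMass F 1 x * cellMass F 2 x + cellMass F 1 x * cellMass F 3 x + cellMass F 2 x * cellMass F 3 x := by ring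
  rw [hp, hq] at h
  exact h

/-- Labels after exchanging petals `0` and `2`. [this work] -/
theorem lab_swap02 (F : Sunflower (Fin n)) (S : Finset (Fin n)) :
    (swapPetals F 0 2).lab S = (if F.lab S = 1 then (3 : Fin 5) else if F.lab S = 2 then (2 : Fin 5) else if F.lab S = 3 then (1 : Fin 5) else F.lab S) := by
  have e0 : Equiv.swap (0 : Fin 3) 2 0 = 2 := by decide
  have e1 : Equiv.swap (0 : Fin 3) 2 1 = 1 := by decide
  have e2 : Equiv.swap (0 : Fin 3) 2 2 = 0 := by decide
  have hx : ∀ {a b : Fin 3}, a ≠ b → S ∈ F.V a → S ∈ F.V b → S ∈ F.A := fun hab ha hb => F.mem_A_of_mem_mem hab ha hb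
  simp only [Sunflower.lab, swapPetals_A]
  simp only [swapPetals_V, e0, e1, e2]
  by_cases hA : S ∈ F.A
  · simp [hA]
  by_cases h0 : S ∈ F.V 0
  · have h1 : S ∉ F.V 1 := fun h => hA (hx (by decide) h0 h)
    have h2 : S ∉ F.V 2 := fun h => hA (hx (by decide) h0 h)
    simp_all
  by_cases h1 : S ∈ F.V 1
  · have h2 : S ∉ F.V 2 := fun h => hA (hx (by decide) h1 h)
    simp_all
  by_cases h2 : S ∈ F.V 2
  · simp [hA, h0, h1, h2]
  · simp [hA, h0, h1, h2]

/-- Cell masses after exchanging petals `0` and `2`. [this work] -/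
theorem cellMass_swap02 (F : Sunflower (Fin n)) (x : Fin n → ℝ) :
    cellMass (swapPetals F 0 2) 0 x = cellMass F 0 x ∧ cellMass (swapPetals F 0 2) 4 x = cellMass F 4 x ∧
    cellMass (swapPetals F 0 2) 1 x = cellMass F 3 x ∧ cellMass (swapPetals F 0 2) 2 x = cellMass F 2 x ∧
    cellMass (swapPetals F 0 2) 3 x = cellMass F 1 x := by
  refine ⟨?_, ?_, ?_, ?_, ?_⟩
  all_goals
    unfold cellMass
    refine sum_congr rfl fun S _ => ?_
    rw [lab_swap02]
    generalize F.lab S = v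
    fin_cases v <;> simp

/-- (C1) transfers from `swapPetals F 0 2` to `F`. [this work] -/
theorem c1_of_swap02 (F : Sunflower (Fin n)) (x : Fin n → ℝ)
    (h : cellMass (swapPetals F 0 2) 1 x * cellMass (swapPetals F 0 2) 2 x * cellMass (swapPetals F 0 2) 3 x ≤
      max (cellMass (swapPetals F 0 2) 4 x) (cellMass (swapPetals F 0 2) 0 x) *
        (cellMass (swapPetals F 0 2) 4 x * cellMass (swapPetals F 0 2) 0 x
          - (cellMass (swapPetals F 0 2) 1 x * cellMass (swapPetals F 0 2) 2 x
            + cellMass (swapPetals F 0 2) 1 x * cellMass (swapPetals F 0 2) 3 x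
            + cellMass (swapPetals F 0 2) 2 x * cellMass (swapPetals F 0 2) 3 x))) :
    cellMass F 1 x * cellMass F 2 x * cellMass F 3 x ≤
      max (cellMass F 4 x) (cellMass F 0 x) *
        (cellMass F 4 x * cellMass F 0 x
          - (cellMass F 1 x * cellMass F 2 x + cellMass F 1 x * cellMass F 3 x + cellMass F 2 x * cellMass F 3 x)) := by
  obtain ⟨hb, ha, e1, e2, e3⟩ := cellMass_swap02 F x
  rw [hb, ha, e1, e2, e3] at h
  have hp : cellMass F 3 x * cellMass F 2 x * cellMass F 1 x = cellMass F 1 x * cellMass F 2 x * cellMass F 3 x := by ring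
  have hq : cellMass F 3 x * cellMass F 2 x + cellMass F 3 x * cellMass F 1 x
      + cellMass F 2 x * cellMass F 1 x =
      cellMass F 1 x * cellMass F 2 x + cellMass F 1 x * cellMass F 3 x + cellMass F 2 x * cellMass F 3 x := by ring
  rw [hp, hq] at h
  exact h

/-- **Soundness of one chunk**: if the chunk `[lo, hi)` passes and the enumeration is complete, then (C1) holds at every bias for
EVERY sunflower on `n` coins whose core has between `lo` and `hi − 1` points (its petals are first sorted by key). [this work] -/
theorem c1_of_allSunTestCard {lo hi : ℕ} (hall : allSunTestCard n lo hi = true)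
    (hcomp : ∀ V : Finset (Finset (Fin n)), InsClosed V → (V, famKey V) ∈ upFams n)
    (F : Sunflower (Fin n)) (hcard : lo ≤ (F.V 0 ∩ F.V 1).card ∧ (F.V 0 ∩ F.V 1).card < hi)
    (x : Fin n → ℝ) (hx : ∀ i, 0 ≤ x i ∧ x i ≤ 1) :
    cellMass F 1 x * cellMass F 2 x * cellMass F 3 x ≤
      max (cellMass F 4 x) (cellMass F 0 x) *
        (cellMass F 4 x * cellMass F 0 x
          - (cellMass F 1 x * cellMass F 2 x + cellMass F 1 x * cellMass F 3 x + cellMass F 2 x * cellMass F 3 x)) := by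
  have S := fun (G : Sunflower (Fin n)) (hc : lo ≤ (G.V 0 ∩ G.V 1).card ∧ (G.V 0 ∩ G.V 1).card < hi)
    (h01 : famKey (G.V 0) ≤ famKey (G.V 1)) (h12 : famKey (G.V 1) ≤ famKey (G.V 2)) =>
    c1_sorted_of_allSunTestCard hall hcomp G hc h01 h12 x hx
  -- card hypotheses for the reordered structures
  have hc01 : lo ≤ ((swapPetals F 0 1).V 0 ∩ (swapPetals F 0 1).V 1).card ∧
      ((swapPetals F 0 1).V 0 ∩ (swapPetals F 0 1).V 1).card < hi := by rw [swapPetals_core]; exact hcard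
  have hc12 : lo ≤ ((swapPetals F 1 2).V 0 ∩ (swapPetals F 1 2).V 1).card ∧
      ((swapPetals F 1 2).V 0 ∩ (swapPetals F 1 2).V 1).card < hi := by rw [swapPetals_core]; exact hcard
  have hc02 : lo ≤ ((swapPetals F 0 2).V 0 ∩ (swapPetals F 0 2).V 1).card ∧
      ((swapPetals F 0 2).V 0 ∩ (swapPetals F 0 2).V 1).card < hi := by rw [swapPetals_core]; exact hcard
  have hc12' : lo ≤ ((swapPetals (swapPetals F 1 2) 0 1).V 0 ∩ (swapPetals (swapPetals F 1 2) 0 1).V 1).card ∧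
      ((swapPetals (swapPetals F 1 2) 0 1).V 0 ∩ (swapPetals (swapPetals F 1 2) 0 1).V 1).card < hi := by
    rw [swapPetals_core, swapPetals_core]; exact hcard
  have hc01' : lo ≤ ((swapPetals (swapPetals F 0 1) 1 2).V 0 ∩ (swapPetals (swapPetals F 0 1) 1 2).V 1).card ∧
      ((swapPetals (swapPetals F 0 1) 1 2).V 0 ∩ (swapPetals (swapPetals F 0 1) 1 2).V 1).card < hi := by
    rw [swapPetals_core, swapPetals_core]; exact hcard
  have s01_0 : Equiv.swap (0 : Fin 3) 1 0 = 1 := by decide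
  have s01_1 : Equiv.swap (0 : Fin 3) 1 1 = 0 := by decide
  have s01_2 : Equiv.swap (0 : Fin 3) 1 2 = 2 := by decide
  have s12_0 : Equiv.swap (1 : Fin 3) 2 0 = 0 := by decide
  have s12_1 : Equiv.swap (1 : Fin 3) 2 1 = 2 := by decide
  have s12_2 : Equiv.swap (1 : Fin 3) 2 2 = 1 := by decide
  have s02_0 : Equiv.swap (0 : Fin 3) 2 0 = 2 := by decide
  have s02_1 : Equiv.swap (0 : Fin 3) 2 1 = 1 := by decide
  have s02_2 : Equiv.swap (0 : Fin 3) 2 2 = 0 := by decide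
  rcases le_total (famKey (F.V 0)) (famKey (F.V 1)) with h01 | h10
  · rcases le_total (famKey (F.V 1)) (famKey (F.V 2)) with h12 | h21
    · exact S F hcard h01 h12
    · rcases le_total (famKey (F.V 0)) (famKey (F.V 2)) with h02 | h20
      · -- order 0, 2, 1
        refine c1_of_swap12 F x (S _ hc12 ?_ ?_) <;> simp only [swapPetals_V, s12_0, s12_1, s12_2] <;> assumption
      · -- order 2, 0, 1
        refine c1_of_swap12 F x (c1_of_swap01 _ x (S _ hc12' ?_ ?_)) <;>
          simp only [swapPetals_V, s01_0, s01_1, s01_2, s12_0, s12_1, s12_2] <;> assumption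
  · rcases le_total (famKey (F.V 0)) (famKey (F.V 2)) with h02 | h20
    · -- order 1, 0, 2
      refine c1_of_swap01 F x (S _ hc01 ?_ ?_) <;> simp only [swapPetals_V, s01_0, s01_1, s01_2] <;> assumption
    · rcases le_total (famKey (F.V 1)) (famKey (F.V 2)) with h12 | h21
      · -- order 1, 2, 0
        refine c1_of_swap01 F x (c1_of_swap12 _ x (S _ hc01' ?_ ?_)) <;>
          simp only [swapPetals_V, s01_0, s01_1, s01_2, s12_0, s12_1, s12_2] <;> assumption
      · -- order 2, 1, 0
        refine c1_of_swap02 F x (S _ hc02 ?_ ?_) <;> simp only [swapPetals_V, s02_0, s02_1, s02_2] <;> assumption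

/-- **Four coins from six chunks**: if the six compiled chunks pass and the mask enumeration of up-sets on four coins is complete,
then (C1) holds for every sunflower on four coins at every bias. [this work] -/
theorem c1_fourCoins_of_chunks (h04 : allSunTestCard 4 0 4 = true) (h45 : allSunTestCard 4 4 5 = true)
    (h56 : allSunTestCard 4 5 6 = true) (h67 : allSunTestCard 4 6 7 = true) (h78 : allSunTestCard 4 7 8 = true)
    (h817 : allSunTestCard 4 8 17 = true)
    (hcomp : ∀ V : Finset (Finset (Fin 4)), InsClosed V → (V, famKey V) ∈ upFams 4)
    (F : Sunflower (Fin 4)) (x : Fin 4 → ℝ) (hx : ∀ i, 0 ≤ x i ∧ x i ≤ 1) :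
    cellMass F 1 x * cellMass F 2 x * cellMass F 3 x ≤
      max (cellMass F 4 x) (cellMass F 0 x) *
        (cellMass F 4 x * cellMass F 0 x
          - (cellMass F 1 x * cellMass F 2 x + cellMass F 1 x * cellMass F 3 x + cellMass F 2 x * cellMass F 3 x)) := by
  set c := (F.V 0 ∩ F.V 1).card with hc
  have hc17 : c < 17 := by
    have h1 : c ≤ (Finset.univ : Finset (Finset (Fin 4))).card := Finset.card_le_univ _
    have h2 : (Finset.univ : Finset (Finset (Fin 4))).card = 16 := by simp
    omega
  by_cases h1 : c < 4
  · exact c1_of_allSunTestCard h04 hcomp F ⟨Nat.zero_le _, h1⟩ x hx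
  by_cases h2 : c < 5
  · exact c1_of_allSunTestCard h45 hcomp F ⟨by omega, h2⟩ x hx
  by_cases h3 : c < 6
  · exact c1_of_allSunTestCard h56 hcomp F ⟨by omega, h3⟩ x hx
  by_cases h4 : c < 7
  · exact c1_of_allSunTestCard h67 hcomp F ⟨by omega, h4⟩ x hx
  by_cases h5 : c < 8
  · exact c1_of_allSunTestCard h78 hcomp F ⟨by omega, h5⟩ x hx
  · exact c1_of_allSunTestCard h817 hcomp F ⟨by omega, hc17⟩ x hx

end C1Cert

end SafeCalc

end Summit.CriticalPhenomena.PercolationContinuityZ3.Theorems.SunflowerPartition
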